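import Summits.QuantumAdvantage.QuantumAdvantage.Theorems.CubicForrelationNearExactIsExactCubicForm
import Summits.QuantumAdvantage.QuantumAdvantage.Theorems.CubicForrelationSignedCubicForrelationNotPrBPPStubKernelNormalFormDegree
import Mathlib.Data.Matrix.Mul

/-!
# Crux `CubicForrelation.NearExactIsExact` (stmt-QuantumAdvantage-14043) — the cubic form under AFFINE CHANGES OF FRAME

Certificate seat `b2b-cforr-cert` (gen 40).  HONEST FRAMING: kernel-checked folklore bookkeeping (standard axioms), companion of
…CubicForm: how a Boolean function `κ : 𝔽₂ⁿ → 𝔽₂`, its weight, its derivatives and its third-difference form behave under an affine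
re-parametrisation `y ↦ b ⊕ P y` (`P` an `n × m` matrix over `𝔽₂`, acting on bit vectors by `(P y)_ψ = [Σ_φ P_{ψφ} y_φ = 1]`).  This is the
"(L4) frames" input of the Lean roadmap for `E1280-even` (HOME/b2b-cforr-cert-g39/E1280-HANDPROOFS.md §3): the even-case analysis of the 12-bit
window is carried out in a frame ADAPTED to a light derivative, and the 3-form transformation law below is exactly the `d'` of
`tps_pair_covariant` (…TwelvePartnerSymplectic), so the pairing partner travels along.  Nothing about `θ₁₂`; NOT summit progress.

* `tct_lin_bxor`, `tct_lin_zeroVec`, `tct_lin_single`: `y ↦ P y` is additive, and `P e_φ` is the `φ`-th column of `P`.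
* `tct_affine_coord_deg`, `tct_comp_isDegLeFun`: the coordinates of `y ↦ b ⊕ P y` are affine, so `κ ∘ (b ⊕ P ·)` has degree `≤ 3` when
  `κ` has (`knf_isDegLeFun_comp`).
* `tct_third_comp`: `D_uD_vD_w (κ ∘ (b ⊕ P·))(x) = D_{Pu}D_{Pv}D_{Pw} κ (b ⊕ P x)` (any `κ`).
* `tct_third_comp_coord` (**the 3-form law**): for `deg κ ≤ 3`, the coordinate tensor of `κ ∘ (b ⊕ P·)` is
  `d'_{φjk} = Σ_{ψ,a,b} P_{ψφ} P_{aj} P_{bk} d_{ψab}` (read in `𝔽₂`), `d` the coordinate tensor of `κ` (…CubicForm `tcf_third_sum1`).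
* `tct_lin_lin`, `tct_card_comp`, `tct_card_deriv_comp`: for a square `P` with inverse `Pi`, `y ↦ b ⊕ P y` is a bijection of `𝔽₂ⁿ`, so the
  weight of `κ` and the number of ones of every derivative `D_{Pa'}κ` are read off in the new frame.
* `tct_third_of_product_slice`: if a derivative `D_aκ` is the product of two affine COORDINATE forms `(y_i ⊕ c₁)(y_j ⊕ c₂)` (the adapted
  R2 frame), then the slice of the form along `a` is `e^i ∧ e^j`: `D_uD_vD_aκ = u_iv_j ⊕ u_jv_i`.

References: C. Carlet (2021) §2.2; F. J. MacWilliams, N. J. A. Sloane (1977) Ch. 13 §3–4.  Axioms: the standard three.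
-/

set_option linter.dupNamespace false -- D-0017: single-problem summit ⇒ `QuantumAdvantage.QuantumAdvantage` by design

namespace Summit.QuantumAdvantage.QuantumAdvantage.Theorems.CubicForrelation.NearExactIsExact

open Finset
open Literature.Computability.QuantumComplexity
open Literature.Computability.QuantumComplexity.BuzetChailloux (bxor zeroVec bxor_comm bxor_self bxor_zeroVec zeroVec_bxor
  bxor_bxor_cancel_left)
open Summit.QuantumAdvantage.QuantumAdvantage.Theorems.SignedCubicForrelationNotPrBPP (knf_isDegLeFun_comp)

variable {n m : ℕ}

/-! ### The linear map `y ↦ P y` on bit vectors -/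

/-- **Additivity** of `y ↦ P y`. [folklore] -/
theorem tct_lin_bxor (P : Fin n → Fin m → ZMod 2) (y y' : Fin m → Bool) :
    (fun ψ => decide ((∑ φ, P ψ φ * (if (bxor y y') φ = true then (1 : ZMod 2) else 0)) = 1)) =
      bxor (fun ψ => decide ((∑ φ, P ψ φ * (if y φ = true then (1 : ZMod 2) else 0)) = 1))
        (fun ψ => decide ((∑ φ, P ψ φ * (if y' φ = true then (1 : ZMod 2) else 0)) = 1)) := by
  funext ψ
  show _ = (decide _ ^^ decide _)
  rw [← tcf_decide_add, ← sum_add_distrib]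
  have hs : (∑ φ, P ψ φ * (if (bxor y y') φ = true then (1 : ZMod 2) else 0)) =
      ∑ φ, (P ψ φ * (if y φ = true then (1 : ZMod 2) else 0) + P ψ φ * (if y' φ = true then 1 else 0)) :=
    sum_congr rfl fun φ _ => by rw [← mul_add, ← tcf_ite_xor]
  rw [hs]

/-- `P 0 = 0`. [folklore] -/
theorem tct_lin_zeroVec (P : Fin n → Fin m → ZMod 2) :
    (fun ψ => decide ((∑ φ, P ψ φ * (if (zeroVec : Fin m → Bool) φ = true then (1 : ZMod 2) else 0)) = 1)) =
      (zeroVec : Fin n → Bool) := by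
  funext ψ
  simp [zeroVec]

/-- `P e_φ` is the `φ`-th column of `P`. [folklore] -/
theorem tct_lin_single (P : Fin n → Fin m → ZMod 2) (φ : Fin m) :
    (fun ψ => decide ((∑ φ', P ψ φ' * (if decide (φ' = φ) = true then (1 : ZMod 2) else 0)) = 1)) =
      fun ψ => decide (P ψ φ = 1) := by
  funext ψ
  have hs : (∑ φ', P ψ φ' * (if decide (φ' = φ) = true then (1 : ZMod 2) else 0)) = P ψ φ := by
    simp only [decide_eq_true_eq, mul_ite, mul_one, mul_zero, sum_ite_eq', mem_univ, if_true]
  rw [hs]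

/-- The coordinates of the affine map `y ↦ b ⊕ P y` have degree `≤ 1`. [folklore] -/
theorem tct_affine_coord_deg (P : Fin n → Fin m → ZMod 2) (b : Fin n → Bool) (ψ : Fin n) :
    IsDegLeFun 1 (fun y : Fin m → Bool =>
      (bxor b (fun ψ => decide ((∑ φ, P ψ φ * (if y φ = true then (1 : ZMod 2) else 0)) = 1))) ψ) := by
  classical
  refine ⟨MvPolynomial.C (if b ψ = true then (1 : ZMod 2) else 0) + ∑ φ, MvPolynomial.C (P ψ φ) * MvPolynomial.X φ, ?_, fun y => ?_⟩
  · refine (MvPolynomial.totalDegree_add _ _).trans (max_le ?_ ?_)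
    · rw [MvPolynomial.totalDegree_C]; exact Nat.zero_le _
    · refine (MvPolynomial.totalDegree_finsetSum _ _).trans (Finset.sup_le fun φ _ => ?_)
      refine (MvPolynomial.totalDegree_mul _ _).trans ?_
      rw [MvPolynomial.totalDegree_C, MvPolynomial.totalDegree_X, zero_add]
  · rw [polyPhase_apply]
    simp only [map_add, map_sum, map_mul, MvPolynomial.eval_C, MvPolynomial.eval_X]
    show (b ψ ^^ decide _) = _
    have hb : ∀ (β : Bool) (t : ZMod 2), (β ^^ decide (t = 1)) = decide ((if β = true then (1 : ZMod 2) else 0) + t = 1) := by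
      decide
    rw [hb]

/-- **Degree under an affine change of frame**: `κ ∘ (b ⊕ P·)` has degree `≤ 3` if `κ` has. [cite: Carlet2020, §2.2] -/
theorem tct_comp_isDegLeFun {d : ℕ} (κ : (Fin n → Bool) → Bool) (hκ : IsDegLeFun d κ) (P : Fin n → Fin m → ZMod 2)
    (b : Fin n → Bool) :
    IsDegLeFun d (fun y : Fin m → Bool =>
      κ (bxor b (fun ψ => decide ((∑ φ, P ψ φ * (if y φ = true then (1 : ZMod 2) else 0)) = 1)))) :=
  knf_isDegLeFun_comp hκ _ fun ψ => tct_affine_coord_deg P b ψ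

/-! ### The third difference under an affine change of frame -/

section Comp

variable (κ : (Fin n → Bool) → Bool) (P : Fin n → Fin m → ZMod 2) (b : Fin n → Bool)

/-- **Transport of the third difference** (any `κ`): `D_uD_vD_w(κ ∘ (b ⊕ P·))(x) = D_{Pu}D_{Pv}D_{Pw}κ(b ⊕ Px)`. [folklore] -/
theorem tct_third_comp (u v w x : Fin m → Bool) :
    let L : (Fin m → Bool) → (Fin n → Bool) :=
      fun y => fun ψ => decide ((∑ φ, P ψ φ * (if y φ = true then (1 : ZMod 2) else 0)) = 1)
    let κ' : (Fin m → Bool) → Bool := fun y => κ (bxor b (L y))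
    (((κ' x ^^ κ' (bxor x w)) ^^ (κ' (bxor x v) ^^ κ' (bxor (bxor x v) w))) ^^
        ((κ' (bxor x u) ^^ κ' (bxor (bxor x u) w)) ^^ (κ' (bxor (bxor x u) v) ^^ κ' (bxor (bxor (bxor x u) v) w)))) =
      (((κ (bxor b (L x)) ^^ κ (bxor (bxor b (L x)) (L w))) ^^
          (κ (bxor (bxor b (L x)) (L v)) ^^ κ (bxor (bxor (bxor b (L x)) (L v)) (L w)))) ^^
        ((κ (bxor (bxor b (L x)) (L u)) ^^ κ (bxor (bxor (bxor b (L x)) (L u)) (L w))) ^^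
          (κ (bxor (bxor (bxor b (L x)) (L u)) (L v)) ^^ κ (bxor (bxor (bxor (bxor b (L x)) (L u)) (L v)) (L w))))) := by
  intro L κ'
  have hL : ∀ y y', L (bxor y y') = bxor (L y) (L y') := fun y y' => tct_lin_bxor P y y'
  simp only [κ', hL, iw_bxor_assoc]

/-- **The 3-form transformation law.**  For `deg κ ≤ 3`, the coordinate tensor of `κ' = κ ∘ (b ⊕ P·)` (values of the third difference
on unit vectors, any base points) is `d'_{φjk} = Σ_{ψ,a,c} P_{ψφ} P_{aj} P_{ck} d_{ψac}` in `𝔽₂` — the `d'` of `tps_pair_covariant`.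
[cite: Carlet2020, §2.2] -/
theorem tct_third_comp_coord (hκ : IsDegLeFun 3 κ) (φ j k : Fin m) (x : Fin m → Bool) (x' : Fin n → Bool) :
    let L : (Fin m → Bool) → (Fin n → Bool) :=
      fun y => fun ψ => decide ((∑ φ, P ψ φ * (if y φ = true then (1 : ZMod 2) else 0)) = 1)
    let κ' : (Fin m → Bool) → Bool := fun y => κ (bxor b (L y))
    (if (((κ' x ^^ κ' (bxor x (fun l => decide (l = k)))) ^^
          (κ' (bxor x (fun l => decide (l = j))) ^^ κ' (bxor (bxor x (fun l => decide (l = j))) (fun l => decide (l = k))))) ^^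
        ((κ' (bxor x (fun l => decide (l = φ))) ^^ κ' (bxor (bxor x (fun l => decide (l = φ))) (fun l => decide (l = k)))) ^^
          (κ' (bxor (bxor x (fun l => decide (l = φ))) (fun l => decide (l = j))) ^^
            κ' (bxor (bxor (bxor x (fun l => decide (l = φ))) (fun l => decide (l = j))) (fun l => decide (l = k)))))) = true
      then (1 : ZMod 2) else 0) =
      ∑ ψ, ∑ a, ∑ c, P ψ φ * P a j * P c k *
        (if (((κ x' ^^ κ (bxor x' (fun l => decide (l = c)))) ^^
              (κ (bxor x' (fun l => decide (l = a))) ^^ κ (bxor (bxor x' (fun l => decide (l = a))) (fun l => decide (l = c))))) ^^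
            ((κ (bxor x' (fun l => decide (l = ψ))) ^^ κ (bxor (bxor x' (fun l => decide (l = ψ))) (fun l => decide (l = c)))) ^^
              (κ (bxor (bxor x' (fun l => decide (l = ψ))) (fun l => decide (l = a))) ^^
                κ (bxor (bxor (bxor x' (fun l => decide (l = ψ))) (fun l => decide (l = a))) (fun l => decide (l = c)))))) = true
          then (1 : ZMod 2) else 0) := by
  intro L κ'
  dsimp only [L, κ']
  have step0 := tct_third_comp κ P b (fun l => decide (l = φ)) (fun l => decide (l = j)) (fun l => decide (l = k)) x
  dsimp only at step0
  rw [step0]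
  -- the images of the unit vectors are the columns of `P`
  rw [tct_lin_single P φ, tct_lin_single P j, tct_lin_single P k]
  -- move to the base point `x'` and expand the first slot
  rw [tcf_third_const κ hκ _ _ _ _ x', tcf_third_sum1 κ hκ (fun ψ => P ψ φ)]
  -- expand the second slot (after a swap), then the third
  have h2 : ∀ ψ : Fin n,
      (if (((κ x' ^^ κ (bxor x' (fun ψ' => decide (P ψ' k = 1)))) ^^
            (κ (bxor x' (fun ψ' => decide (P ψ' j = 1))) ^^ κ (bxor (bxor x' (fun ψ' => decide (P ψ' j = 1))) (fun ψ' => decide (P ψ' k = 1))))) ^^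
          ((κ (bxor x' (fun l => decide (l = ψ))) ^^ κ (bxor (bxor x' (fun l => decide (l = ψ))) (fun ψ' => decide (P ψ' k = 1)))) ^^
            (κ (bxor (bxor x' (fun l => decide (l = ψ))) (fun ψ' => decide (P ψ' j = 1))) ^^
              κ (bxor (bxor (bxor x' (fun l => decide (l = ψ))) (fun ψ' => decide (P ψ' j = 1))) (fun ψ' => decide (P ψ' k = 1)))))) = true
        then (1 : ZMod 2) else 0) =
      ∑ a, P a j * ∑ c, P c k *
        (if (((κ x' ^^ κ (bxor x' (fun l => decide (l = c)))) ^^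
              (κ (bxor x' (fun l => decide (l = a))) ^^ κ (bxor (bxor x' (fun l => decide (l = a))) (fun l => decide (l = c))))) ^^
            ((κ (bxor x' (fun l => decide (l = ψ))) ^^ κ (bxor (bxor x' (fun l => decide (l = ψ))) (fun l => decide (l = c)))) ^^
              (κ (bxor (bxor x' (fun l => decide (l = ψ))) (fun l => decide (l = a))) ^^
                κ (bxor (bxor (bxor x' (fun l => decide (l = ψ))) (fun l => decide (l = a))) (fun l => decide (l = c)))))) = true
          then (1 : ZMod 2) else 0) := by
    intro ψ
    rw [tcf_third_swap12 κ (fun l => decide (l = ψ)) (fun ψ' => decide (P ψ' j = 1)) (fun ψ' => decide (P ψ' k = 1)) x',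
      tcf_third_sum1 κ hκ (fun a => P a j)]
    refine sum_congr rfl fun a _ => ?_
    congr 1
    rw [tcf_third_swap23 κ (fun l => decide (l = a)) (fun l => decide (l = ψ)) (fun ψ' => decide (P ψ' k = 1)) x',
      tcf_third_swap12 κ (fun l => decide (l = a)) (fun ψ' => decide (P ψ' k = 1)) (fun l => decide (l = ψ)) x',
      tcf_third_sum1 κ hκ (fun c => P c k)]
    refine sum_congr rfl fun c _ => ?_
    congr 1
    rw [tcf_third_swap12 κ (fun l => decide (l = c)) (fun l => decide (l = a)) (fun l => decide (l = ψ)) x',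
      tcf_third_swap23 κ (fun l => decide (l = a)) (fun l => decide (l = c)) (fun l => decide (l = ψ)) x',
      tcf_third_swap12 κ (fun l => decide (l = a)) (fun l => decide (l = ψ)) (fun l => decide (l = c)) x']
  simp only [h2, mul_sum]
  refine sum_congr rfl fun ψ _ => sum_congr rfl fun a _ => sum_congr rfl fun c _ => ?_
  ring

end Comp

/-! ### Invertible frames: bijectivity, weights and derivative counts -/

section Square

variable (P : Fin n → Fin m → ZMod 2) (Pi : Fin m → Fin n → ZMod 2)

/-- Composition of the bit-vector actions of two matrices is the action of the product. [folklore] -/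
theorem tct_lin_lin (y : Fin n → Bool) :
    (fun ψ => decide ((∑ φ, P ψ φ * (if (fun χ => decide ((∑ ω, Pi χ ω * (if y ω = true then (1 : ZMod 2) else 0)) = 1)) φ = true
        then (1 : ZMod 2) else 0)) = 1)) =
      fun ψ => decide ((∑ ω, (∑ φ, P ψ φ * Pi φ ω) * (if y ω = true then (1 : ZMod 2) else 0)) = 1) := by
  funext ψ
  have hread : ∀ t : ZMod 2, (if decide (t = 1) = true then (1 : ZMod 2) else 0) = t := by decide
  congr 2
  simp only [hread, mul_sum, sum_mul]
  rw [sum_comm]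
  exact sum_congr rfl fun φ _ => sum_congr rfl fun ω _ => by ring

/-- If `P Pi = 1` then `P (Pi y) = y`. [folklore] -/
theorem tct_lin_inv (hPPi : ∀ ψ ω, (∑ φ, P ψ φ * Pi φ ω) = if ψ = ω then 1 else 0) (y : Fin n → Bool) :
    (fun ψ => decide ((∑ φ, P ψ φ * (if (fun χ => decide ((∑ ω, Pi χ ω * (if y ω = true then (1 : ZMod 2) else 0)) = 1)) φ = true
        then (1 : ZMod 2) else 0)) = 1)) = y := by
  rw [tct_lin_lin]
  funext ψ
  simp only [hPPi, ite_mul, one_mul, zero_mul, sum_ite_eq, mem_univ, if_true]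
  cases y ψ <;> decide

/-- **Counting through an invertible affine map** (generic form): if `L : 𝔽₂ᵐ → 𝔽₂ⁿ` and `Li` are mutually inverse, then
`#{y : p (b ⊕ L y)} = #{x : p x}`. [folklore] -/
theorem tct_card_comp_of_inverse (L : (Fin m → Bool) → (Fin n → Bool)) (Li : (Fin n → Bool) → (Fin m → Bool))
    (h1 : ∀ y, L (Li y) = y) (h2 : ∀ x, Li (L x) = x)
    (b : Fin n → Bool) (p : (Fin n → Bool) → Prop) [DecidablePred p] :
    #(univ.filter fun y : Fin m → Bool => p (bxor b (L y))) = #(univ.filter fun x : Fin n → Bool => p x) := by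
  classical
  let E : (Fin m → Bool) ≃ (Fin n → Bool) :=
    ⟨fun y => bxor b (L y), fun x => Li (bxor b x), fun y => by
      show Li (bxor b (bxor b (L y))) = y
      rw [bxor_bxor_cancel_left, h2], fun x => by
      show bxor b (L (Li (bxor b x))) = x
      rw [h1, bxor_bxor_cancel_left]⟩
  refine card_equiv E fun y => ?_
  simp only [mem_filter, mem_univ, true_and]
  exact Iff.rfl

/-- **Counting through an invertible affine change of frame.**  If `P Pi = 1` and `Pi P = 1` then for every predicate `p` on `𝔽₂ⁿ`,
`#{y : p (b ⊕ P y)} = #{x : p x}`. [folklore] -/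
theorem tct_card_comp (hPPi : ∀ ψ ω, (∑ φ, P ψ φ * Pi φ ω) = if ψ = ω then 1 else 0)
    (hPiP : ∀ ψ ω, (∑ φ, Pi ψ φ * P φ ω) = if ψ = ω then 1 else 0) (b : Fin n → Bool) (p : (Fin n → Bool) → Prop)
    [DecidablePred p] :
    #(univ.filter fun y : Fin m → Bool =>
        p (bxor b (fun ψ => decide ((∑ φ, P ψ φ * (if y φ = true then (1 : ZMod 2) else 0)) = 1)))) =
      #(univ.filter fun x : Fin n → Bool => p x) :=
  tct_card_comp_of_inverse (fun y => fun ψ => decide ((∑ φ, P ψ φ * (if y φ = true then (1 : ZMod 2) else 0)) = 1))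
    (fun y => fun ψ => decide ((∑ φ, Pi ψ φ * (if y φ = true then (1 : ZMod 2) else 0)) = 1))
    (tct_lin_inv P Pi hPPi) (tct_lin_inv Pi P hPiP) b p

/-- **Derivative counts in the new frame.**  With `κ' = κ ∘ (b ⊕ P·)` and `P` invertible:
`#{y : κ'(y) ≠ κ'(y ⊕ a')} = #{x : κ(x) ≠ κ(x ⊕ P a')}`. [folklore] -/
theorem tct_card_deriv_comp (κ : (Fin n → Bool) → Bool)
    (hPPi : ∀ ψ ω, (∑ φ, P ψ φ * Pi φ ω) = if ψ = ω then 1 else 0)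
    (hPiP : ∀ ψ ω, (∑ φ, Pi ψ φ * P φ ω) = if ψ = ω then 1 else 0) (b : Fin n → Bool) (a' : Fin m → Bool) :
    let L : (Fin m → Bool) → (Fin n → Bool) :=
      fun y => fun ψ => decide ((∑ φ, P ψ φ * (if y φ = true then (1 : ZMod 2) else 0)) = 1)
    (univ.filter fun y : Fin m → Bool => (κ (bxor b (L y)) ^^ κ (bxor b (L (bxor y a')))) = true).card =
      (univ.filter fun x : Fin n → Bool => (κ x ^^ κ (bxor x (L a'))) = true).card := by
  intro L
  have hL : ∀ y, L (bxor y a') = bxor (L y) (L a') := fun y => tct_lin_bxor P y a'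
  simp only [hL, ← iw_bxor_assoc]
  exact tct_card_comp P Pi hPPi hPiP b (fun x => (κ x ^^ κ (bxor x (L a'))) = true)

/-- **Weights in the new frame**: `#{y : κ(b ⊕ P y)} = #{x : κ x}` for invertible `P`. [folklore] -/
theorem tct_card_comp_eq (κ : (Fin n → Bool) → Bool)
    (hPPi : ∀ ψ ω, (∑ φ, P ψ φ * Pi φ ω) = if ψ = ω then 1 else 0)
    (hPiP : ∀ ψ ω, (∑ φ, Pi ψ φ * P φ ω) = if ψ = ω then 1 else 0) (b : Fin n → Bool) :
    #(univ.filter fun y : Fin m → Bool =>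
        κ (bxor b (fun ψ => decide ((∑ φ, P ψ φ * (if y φ = true then (1 : ZMod 2) else 0)) = 1))) = true) =
      #(univ.filter fun x : Fin n → Bool => κ x = true) :=
  tct_card_comp P Pi hPPi hPiP b (fun x => κ x = true)

end Square

/-! ### The slice of the form along a direction whose derivative is a product of two coordinate forms -/

/-- **Product slice.**  If `D_aκ(y) = (y_i ⊕ c₁)(y_j ⊕ c₂)` for all `y` (the derivative along `a` is the indicator of a codimension-2
coordinate flat — the adapted R2 frame), then `D_uD_vD_aκ = u_iv_j ⊕ u_jv_i` at every base point: the slice `ι_a d` is `e^i ∧ e^j`.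
[folklore] -/
theorem tct_third_of_product_slice (κ : (Fin n → Bool) → Bool) (a : Fin n → Bool) (i j : Fin n) (c₁ c₂ : Bool)
    (hq : ∀ y, (κ y ^^ κ (bxor y a)) = ((y i ^^ c₁) && (y j ^^ c₂))) (u v x : Fin n → Bool) :
    (((κ x ^^ κ (bxor x a)) ^^ (κ (bxor x v) ^^ κ (bxor (bxor x v) a))) ^^
        ((κ (bxor x u) ^^ κ (bxor (bxor x u) a)) ^^ (κ (bxor (bxor x u) v) ^^ κ (bxor (bxor (bxor x u) v) a)))) =
      ((u i && v j) ^^ (u j && v i)) := by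
  rw [hq, hq, hq, hq]
  clear hq
  simp only [bxor]
  generalize x i = xi; generalize x j = xj; generalize u i = ui; generalize u j = uj
  generalize v i = vi; generalize v j = vj
  revert xi xj ui uj vi vj c₁ c₂
  decide

end Summit.QuantumAdvantage.QuantumAdvantage.Theorems.CubicForrelation.NearExactIsExact
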